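import Literature.NumberTheory.LFunctions.TaoLogElliottReduction
import Mathlib.MeasureTheory.Integral.IntervalIntegral.Basic
import HarnessLib

/-!
# Tao's log-averaged Elliott theorem: the architecture of the proof of Theorem 2.3

Second decomposition layer below the named fact `Literature.NumberTheory.LFunctions.tao_log_averaged_elliott_two`
(Tao, Forum Math. Pi 4 (2016) e8, Theorem 1.3), parallel to the §2 reduction
(`TaoLogElliottReduction.lean`, `…Section2.lean`, `…CMization.lean`, `…Unimodular.lean`):
here the remaining named fact `Literature.NumberTheory.LFunctions.Tao2016_theorem23` (Tao 2016, Theorem 2.3) is split along the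
one seam the paper itself marks.  The proof of Theorem 2.3 (by contradiction, §2 from (2.6) on, §3,
§4) uses the non-pretentiousness hypothesis (2.7) exactly once, in Proposition 2.4, where the
Matomäki–Radziwiłł–Tao exponential sum estimate turns it into the bound (2.10) on short
exponential sums of `g₁` at all scales `H ∈ [H₋, H₊]`; the paper then says: "We remark that
Proposition 2.4 is the only way in which we will take advantage of the hypothesis (2.7), which may
now be discarded in the arguments that follow."  Accordingly:

* `Literature.NumberTheory.LFunctions.MatomakiRadziwillTao2015_theorem17` — NAMED FACT (Matomäki–Radziwiłł–Tao, Algebra &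
  Number Theory 9 (2015), Theorem 1.7, the exponential sum estimate), the input of Prop. 2.4.
* `Literature.NumberTheory.LFunctions.Tao2016_prop24` — NAMED FACT (Tao 2016, Proposition 2.4): under the hypotheses of
  Theorem 2.3, for `A` large depending on `H₊`, the short exponential sums of `g₁` obey (2.10) for
  all scales `H₀ ≤ H ≤ H₊`.
* `Literature.NumberTheory.LFunctions.Tao2016_theorem23_core` — NAMED FACT (Tao 2016, the proof of Theorem 2.3 from (2.10) on:
  §2 after Prop. 2.4, §3, §4): for completely multiplicative `S¹`-valued `g₁, g₂`, the bound
  (2.10) at all scales `H ∈ [H₋, H₊]` (with `H₋`, then `H₊`, then `A` sufficiently large) forces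
  `|∑_{x/ω < n ≤ x} g₁(an+b) g₂(an+b+h)/n| ≤ ε log ω`.  (Inputs of its printed proof: Lemma 2.5,
  Prop. 2.6, the entropy decrement argument Lemma 3.2, Lemmas 3.3–3.6 (Hoeffding's inequality,
  the circle method) and Lemma 3.7, which rests on the Green–Tao restriction estimate for the
  primes.)
* `Literature.NumberTheory.LFunctions.Tao2016_theorem23_of_parts` — PROVED: `Tao2016_prop24 → Tao2016_theorem23_core →
  Tao2016_theorem23`, whence `Literature.NumberTheory.LFunctions.tao_log_averaged_elliott_two_of_core_parts` (with the §2
  reduction `Literature.NumberTheory.LFunctions.Tao2016_section2_reduction`).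

## References
* T. Tao, *The logarithmically averaged Chowla and Elliott conjectures for two-point
  correlations*, Forum Math. Pi 4 (2016), e8; arXiv:1509.05422: Theorem 2.3, the hierarchy of
  parameters following it, (2.6)–(2.8), Proposition 2.4 with (2.10) and the remark following it,
  and §§3–4.
* K. Matomäki, M. Radziwiłł, T. Tao, *An averaged form of Chowla's conjecture*, Algebra & Number
  Theory 9 (2015), 2167–2196; arXiv:1503.05121, §1.1 (the quantity `M(g; X, Q)`) and Theorem 1.7.

## Design choices
* `e(θ) = exp(2πiθ)` is written `Complex.exp (2 * π * I * θ)`.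
* MRT 2015, Thm 1.7: `X ≥ H ≥ 10` real; "`1`-bounded multiplicative" as elsewhere in the tree
  (`ArithmeticFunction ℂ`, `IsMultiplicative`, `‖g n‖ ≤ 1`); `M(g; X, Q)` is the tree's
  `Literature.nonpretentiousness g X Q` (`PretentiousDistance.lean`, Tao 2016 (1.8) = MRT 2015 §1.1; for
  `X ≥ 10` the level `Q = min(log^{1/125} X, log⁵ H) ≥ 1`, so no junk value arises); the integers of
  `[x, x + H]` for real `x ≥ 0` are `Finset.Icc ⌈x⌉₊ ⌊x + H⌋₊`; "`≪`" with an absolute constant is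
  `∃ C` outermost.
* Prop. 2.4 is printed under the standing assumptions of the contradiction argument ("Let the
  notation and assumptions be as above"), of which its statement and proof use: `g₁` completely
  multiplicative and `S¹`-valued, (2.6)–(2.7) (`x ≥ ω ≥ A`, `ω ≤ x / log x`, hypothesis (2.2) at
  level `A`), and "`A` sufficiently large depending on `H₊`"; the parameters `a, b, h, ε, g₂` and
  the lower scale `H₋` play no role in (2.10), whose implied constant is absolute, so we quantify
  `∃ C H₀, ∀ H₊, ∃ A₀, ∀ A ≥ A₀, …, ∀ H ∈ [H₀, H₊]` (`H₀ ≥ 3` absolute makes `log log H / log H`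
  meaningful; the paper has `H ≥ H₋ ≥ 1/ε`).
* The core is quantified following the printed hierarchy "choose `H₋` sufficiently large
  (depending on `a, b, h, ε`), then `H₊` sufficiently large depending on `H₋`, then `A`
  sufficiently large depending on `H₊`": `∀ C H₀, ∃ H₋ ≥ H₀, ∃ H₊ ≥ H₋, ∃ A₀, ∀ A ≥ A₀`, the bound
  (2.10) with constant `C` on `[H₋, H₊]` being the hypothesis replacing (2.7).  The conclusion is the
  negation of (2.8), i.e. the conclusion of Theorem 2.3, with the same `Int.toNat` conventions as
  `Literature.NumberTheory.LFunctions.Tao2016_theorem23`.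
-/

open Finset Complex MeasureTheory

namespace Literature.NumberTheory.LFunctions

/-- The short exponential sum `∑_{j=1}^{H} g(n + j) e(jα)` of Tao 2016, (2.10).
[cite: TaoFMP2016, (2.10)] -/
noncomputable def shortExpSum (g : ℕ → ℂ) (n H : ℕ) (α : ℝ) : ℂ :=
  ∑ j ∈ Icc 1 H, g (n + j) * Complex.exp (2 * Real.pi * Complex.I * (j : ℂ) * (α : ℂ))

/-- The left-hand side of Tao 2016, (2.10) at a fixed frequency `α`:
`∑_{x/ω < n ≤ x} (1/(Hn)) |∑_{j=1}^H g(n+j) e(jα)|`. [cite: TaoFMP2016, (2.10)] -/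
noncomputable def logAvgShortExpSum (g : ℕ → ℂ) (x ω : ℝ) (H : ℕ) (α : ℝ) : ℝ :=
  ∑ n ∈ Ioc ⌊x / ω⌋₊ ⌊x⌋₊, ‖shortExpSum g n H α‖ / ((H : ℝ) * n)

/-- NAMED FACT — **Matomäki–Radziwiłł–Tao 2015, Theorem 1.7** (exponential sum estimate; Algebra &
Number Theory 9 (2015), Thm 1.7, as printed): "Let `X ≥ H ≥ 10` and let `g` be a `1`-bounded
multiplicative function. Then
`sup_{α ∈ 𝕋} ∫_0^X |∑_{x ≤ n ≤ x+H} g(n) e(αn)| dx ≪ (exp(-M(g; X, Q)/20) + log log H / log H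
+ 1 / log^{1/700} X) H X`, where `Q := min(log^{1/125} X, log⁵ H)`."  Here
`M(g; X, Q) = inf_{|t| ≤ X; q ≤ Q; χ (q)} 𝔻(g, χ(n) n^{it}; X)²` is `Literature.nonpretentiousness g X Q`.
Users take `(h : MatomakiRadziwillTao2015_theorem17)`. [cite: MatomakiRadziwillTao2015, Theorem 1.7] -/
def MatomakiRadziwillTao2015_theorem17 : Prop :=
  ∃ C : ℝ, ∀ g : ArithmeticFunction ℂ, g.IsMultiplicative → (∀ n, ‖g n‖ ≤ 1) →
    ∀ X H : ℝ, 10 ≤ H → H ≤ X → ∀ α : ℝ,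
      ∫ x in (0 : ℝ)..X,
          ‖∑ n ∈ Icc ⌈x⌉₊ ⌊x + H⌋₊, g n * Complex.exp (2 * Real.pi * Complex.I * (α : ℂ) * (n : ℂ))‖
        ≤ C * (Real.exp (-(Sieve.nonpretentiousness g X
                (min (Real.log X ^ (1 / 125 : ℝ)) (Real.log H ^ (5 : ℝ)))) / 20)
              + Real.log (Real.log H) / Real.log H + 1 / Real.log X ^ (1 / 700 : ℝ)) * H * X

/-- NAMED FACT — **Tao 2016, Proposition 2.4** (Forum Math. Pi 4 (2016) e8, Prop. 2.4: "Let the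
notation and assumptions be as above. For all `H₋ ≤ H ≤ H₊`, one has
`sup_α ∑_{x/ω < n ≤ x} (1/(Hn)) |∑_{j=1}^H g₁(n+j) e(jα)| ≪ (log log H / log H) log ω`" (2.10);
proved from Matomäki–Radziwiłł–Tao 2015 with `W = log⁵ H`).  The standing assumptions used are:
`g₁ : ℕ → S¹` completely multiplicative, `x ≥ x/log x ≥ ω ≥ A` (2.6), hypothesis (2.2) = (2.7) at
level `A` and height `x`, and "`A` sufficiently large depending on `H₊`"; the implied constant is
absolute and `H ≥ H₀` (absolute) replaces `H ≥ H₋`; see the module docstring.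
Users take `(h : Tao2016_prop24)`. [cite: TaoFMP2016, Proposition 2.4] -/
def Tao2016_prop24 : Prop :=
  ∃ C : ℝ, ∃ H₀ : ℕ, ∀ Hplus : ℕ, ∃ A₀ : ℝ, ∀ A : ℝ, A₀ ≤ A →
    ∀ x ω : ℝ, A ≤ ω → ω ≤ x / Real.log x → ω ≤ x →
      ∀ g₁ : ℕ → ℂ,
        (∀ m n : ℕ, 1 ≤ m → 1 ≤ n → g₁ (m * n) = g₁ m * g₁ n) →
        (∀ n : ℕ, 1 ≤ n → ‖g₁ n‖ = 1) →
        (∀ (q : ℕ) (χ : DirichletCharacter ℂ q) (t : ℝ), 1 ≤ q → (q : ℝ) ≤ A → |t| ≤ A * x →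
          A ≤ Sieve.pretentiousDistSq g₁ (Sieve.twistedChar χ t) x) →
        ∀ H : ℕ, H₀ ≤ H → H ≤ Hplus → ∀ α : ℝ,
          logAvgShortExpSum g₁ x ω H α
            ≤ C * (Real.log (Real.log H) / Real.log H) * Real.log ω

/-- NAMED FACT — **Tao 2016, the proof of Theorem 2.3 from (2.10)** (Forum Math. Pi 4 (2016) e8:
§2 from the remark after Proposition 2.4 — "Proposition 2.4 is the only way in which we will take
advantage of the hypothesis (2.7), which may now be discarded in the arguments that follow" —
through Lemma 2.5, Proposition 2.6, §3 (entropy decrement argument, Lemmas 3.2–3.7) and §4).  In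
the printed hierarchy (`H₋` sufficiently large depending on `a, b, h, ε`; `H₊` sufficiently large
depending on `H₋`; `A` sufficiently large depending on `H₊`): if `g₁, g₂ : ℕ → S¹` are completely
multiplicative, `x ≥ x / log x ≥ ω ≥ A`, and the short exponential sums of `g₁` satisfy (2.10) with
constant `C` for all `H₋ ≤ H ≤ H₊`, then `|∑_{x/ω < n ≤ x} g₁(an+b) g₂(an+b+h)/n| ≤ ε log ω` (the
negation of (2.8)).  Users take `(h : Tao2016_theorem23_core)`.
[cite: TaoFMP2016, §2 (after Proposition 2.4), §3 and §4] -/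
def Tao2016_theorem23_core : Prop :=
  ∀ (a : ℕ) (b h : ℤ), 1 ≤ a → h ≠ 0 → ∀ (ε C : ℝ) (H₀ : ℕ), 0 < ε →
    ∃ Hminus Hplus : ℕ, H₀ ≤ Hminus ∧ Hminus ≤ Hplus ∧
      ∃ A₀ : ℝ, ∀ A : ℝ, A₀ ≤ A → ∀ x ω : ℝ, A ≤ ω → ω ≤ x / Real.log x → ω ≤ x →
        ∀ g₁ g₂ : ℕ → ℂ,
          (∀ m n : ℕ, 1 ≤ m → 1 ≤ n → g₁ (m * n) = g₁ m * g₁ n) →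
          (∀ m n : ℕ, 1 ≤ m → 1 ≤ n → g₂ (m * n) = g₂ m * g₂ n) →
          (∀ n : ℕ, 1 ≤ n → ‖g₁ n‖ = 1) → (∀ n : ℕ, 1 ≤ n → ‖g₂ n‖ = 1) →
          (∀ H : ℕ, Hminus ≤ H → H ≤ Hplus → ∀ α : ℝ,
            logAvgShortExpSum g₁ x ω H α
              ≤ C * (Real.log (Real.log H) / Real.log H) * Real.log ω) →
          ‖∑ n ∈ Ioc ⌊x / ω⌋₊ ⌊x⌋₊,
              g₁ ((a : ℤ) * n + b).toNat * g₂ ((a : ℤ) * n + b + h).toNat / (n : ℂ)‖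
            ≤ ε * Real.log ω

/-- **Theorem 2.3 from its two parts** (Tao 2016, the architecture of §§2–4): Proposition 2.4
supplies (2.10) on `[H₋, H₊] ⊆ [H₀, H₊]` once `A` is large depending on `H₊`, and the core
argument concludes. [cite: TaoFMP2016, §2 (Proposition 2.4 and the remark following it)] -/
theorem Tao2016_theorem23_of_parts (h24 : Tao2016_prop24) (hcore : Tao2016_theorem23_core) :
    Tao2016_theorem23 := by
  intro a b h ha hh ε hε
  obtain ⟨C, H₀, h24'⟩ := h24
  obtain ⟨Hminus, Hplus, hH₀, _hH, A₁, hcore'⟩ := hcore a b h ha hh ε C H₀ hε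
  obtain ⟨A₂, h24''⟩ := h24' Hplus
  refine ⟨max A₁ A₂, ?_⟩
  intro A hA x ω hAω hωx hωx' g₁ g₂ hg₁ hg₂ hc₁ hc₂ hhyp
  exact hcore' A ((le_max_left _ _).trans hA) x ω hAω hωx hωx' g₁ g₂ hg₁ hg₂ hc₁ hc₂
    (fun H hH₁ hH₂ α => h24'' A ((le_max_right _ _).trans hA) x ω hAω hωx hωx' g₁ hg₁ hc₁ hhyp H
      (hH₀.trans hH₁) hH₂ α)

/-- **Theorem 1.3 from the parts of Theorem 2.3 and the §2 reduction.** [cite: TaoFMP2016, §2] -/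
theorem tao_log_averaged_elliott_two_of_core_parts (hred : Tao2016_section2_reduction)
    (h24 : Tao2016_prop24) (hcore : Tao2016_theorem23_core) : tao_log_averaged_elliott_two :=
  hred (Tao2016_theorem23_of_parts h24 hcore)

end Literature.NumberTheory.LFunctions
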